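import Summits.CriticalPhenomena.PercolationContinuityZ3.Theorems.SahiCMTP2Density
import Literature.MathematicalPhysics.KineticTheory.HardSphereEulerProofs
import Mathlib.MeasureTheory.Covering.Besicovitch
import Mathlib.MeasureTheory.Covering.BesicovitchVectorSpace

/-!
# Fuchs–Wang (5.1) ⟹ (1.2) almost everywhere: the density of the slices is mtp₂ on almost every pair

Support file of the Sahi cell (`prim-sahi`, typer seat, generation 18; `--supports stmt-CriticalPhenomena-4575`).
Theorems only (no definitions, no named facts, no sorries).

[FuchsWang2026] §5 asks for "the equivalence between (5.1) and (1.2) when `X_A` has a density `f_{X_A}` with respect to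
the product measure".  `SahiCMTP2Density.lean` proves (1.2) ⟹ (5.1).  Here, the converse IN THE ALMOST-EVERYWHERE SENSE:
if the first marginal of `μ` has a density `f` with respect to a product `π = ⊗ᵢ ρᵢ` of finite measures on `ℝ^A`, `K` is
a version of the conditional law of the second block, and `μ` satisfies the box form of (5.1), then for all `x, y` the
function `g(u, z) := K(u)(−∞,z] · f(u)` of (1.2) satisfies the mtp₂ inequality
`g(u,x) g(v,y) ≤ g(u ∧ v, x ∧ y) g(u ∨ v, x ∨ y)` for `π ⊗ π`-ALMOST EVERY pair `(u, v)`
(**`ae_pair_mtp2_of_isCMTP2Box`**).  Ingredients: the slices `C ↦ μ(C × (−∞,z])` are `π`-with-density `g(·,z)`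
(`slice_eq_withDensity`); Besicovitch–Lebesgue differentiation along sup-norm balls (= closed boxes, on which (5.1)
applies: `closedBall_eq_Icc_pi`) with the product identity `π(B(u,r)) π(B(v,r)) = π(B(u∧v,r)) π(B(u∨v,r))`
(`pi_closedBall_mul_eq`); and quasi-invariance of `π ⊗ π` under `(u,v) ↦ u ∧ v, u ∨ v`
(`prod_map_inf_absolutelyContinuous`, `prod_map_sup_absolutelyContinuous`: the law of the coordinatewise min/max of two
independent `π`-vectors is again absolutely continuous with respect to `π`).

What remains between this and the paper's (1.2) ("there exist versions … for which the displayed map satisfies the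
stated mtp₂ inequality" everywhere) is a modification on a null set of pairs — the analogue of the regularisation behind
[MullerStoyan2002] Thm. 3.10.14 which [FuchsWang2026] name as the missing step; not treated here.  No sorries, no new
axioms.
-/

noncomputable section

namespace Summit.CriticalPhenomena.PercolationContinuityZ3.Theorems.SahiCMTP2

open MeasureTheory ProbabilityTheory Set Filter Topology Function Metric
open Literature.Probability.LatticeModels Literature.Probability.LatticeModels.Affiliation
open scoped ENNReal SetFamily ProbabilityTheory

variable {ι : Type*} [Fintype ι]

/-! ### Quasi-invariance of `π ⊗ π` under coordinatewise min / max -/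

section QuasiInvariance

omit [Fintype ι] in
/-- `(u,v) ↦ u ∧ v` is measurable on `ℝ^ι × ℝ^ι`. [folklore] -/
theorem measurable_inf_pi : Measurable fun p : (ι → ℝ) × (ι → ℝ) => p.1 ⊓ p.2 :=
  measurable_pi_iff.2 fun i =>
    ((measurable_pi_apply i).comp measurable_fst).min ((measurable_pi_apply i).comp measurable_snd)

omit [Fintype ι] in
/-- `(u,v) ↦ u ∨ v` is measurable on `ℝ^ι × ℝ^ι`. [folklore] -/
theorem measurable_sup_pi : Measurable fun p : (ι → ℝ) × (ι → ℝ) => p.1 ⊔ p.2 :=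
  measurable_pi_iff.2 fun i =>
    ((measurable_pi_apply i).comp measurable_fst).max ((measurable_pi_apply i).comp measurable_snd)

/-- The law of `min(s,t)` for independent `s, t ∼ ρ` (finite) is absolutely continuous with respect to `ρ`. [folklore] -/
theorem map_min_prod_absolutelyContinuous (ρ : Measure ℝ) [IsFiniteMeasure ρ] :
    (ρ.prod ρ).map (fun q : ℝ × ℝ => min q.1 q.2) ≪ ρ := by
  refine Measure.AbsolutelyContinuous.mk fun s hs h0 => ?_
  rw [Measure.map_apply (measurable_fst.min measurable_snd) hs]
  have hsub : (fun q : ℝ × ℝ => min q.1 q.2) ⁻¹' s ⊆ s ×ˢ univ ∪ univ ×ˢ s := by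
    intro q hq
    rcases min_choice q.1 q.2 with h | h
    · exact Or.inl ⟨by simpa [h] using hq, trivial⟩
    · exact Or.inr ⟨trivial, by simpa [h] using hq⟩
  refine measure_mono_null hsub (measure_union_null ?_ ?_)
  · rw [Measure.prod_prod, h0, zero_mul]
  · rw [Measure.prod_prod, h0, mul_zero]

/-- Dually for `max`. [folklore] -/
theorem map_max_prod_absolutelyContinuous (ρ : Measure ℝ) [IsFiniteMeasure ρ] :
    (ρ.prod ρ).map (fun q : ℝ × ℝ => max q.1 q.2) ≪ ρ := by
  refine Measure.AbsolutelyContinuous.mk fun s hs h0 => ?_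
  rw [Measure.map_apply (measurable_fst.max measurable_snd) hs]
  have hsub : (fun q : ℝ × ℝ => max q.1 q.2) ⁻¹' s ⊆ s ×ˢ univ ∪ univ ×ˢ s := by
    intro q hq
    rcases max_choice q.1 q.2 with h | h
    · exact Or.inl ⟨by simpa [h] using hq, trivial⟩
    · exact Or.inr ⟨trivial, by simpa [h] using hq⟩
  refine measure_mono_null hsub (measure_union_null ?_ ?_)
  · rw [Measure.prod_prod, h0, zero_mul]
  · rw [Measure.prod_prod, h0, mul_zero]

/-- **A product of absolutely continuous finite measures is absolutely continuous with respect to the product** (through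
the product density `∏ᵢ dλᵢ/dρᵢ`). [folklore] -/
theorem pi_absolutelyContinuous_pi {ρ ν : ι → Measure ℝ} [∀ i, IsFiniteMeasure (ρ i)] [∀ i, IsFiniteMeasure (ν i)]
    (h : ∀ i, ν i ≪ ρ i) : Measure.pi ν ≪ Measure.pi ρ := by
  have hν : ∀ i, (ρ i).withDensity ((ν i).rnDeriv (ρ i)) = ν i := fun i => Measure.withDensity_rnDeriv_eq _ _ (h i)
  have hσ : ∀ i, SigmaFinite ((ρ i).withDensity ((ν i).rnDeriv (ρ i))) := fun i => by rw [hν i]; infer_instance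
  have hpi : Measure.pi ν = (Measure.pi ρ).withDensity (fun w => ∏ i, (ν i).rnDeriv (ρ i) (w i)) := by
    rw [← Literature.MathematicalPhysics.KineticTheory.pi_withDensity_eq ρ (fun i => Measure.measurable_rnDeriv _ _) hσ]
    simp_rw [hν]
  rw [hpi]
  exact withDensity_absolutelyContinuous _ _

/-- **Quasi-invariance under the meet**: for `π = ⊗ᵢ ρᵢ` (finite factors) on `ℝ^ι`, the law of `u ∧ v` for independent
`u, v ∼ π` is absolutely continuous with respect to `π`. [this work] -/
theorem prod_map_inf_absolutelyContinuous (ρ : ι → Measure ℝ) [∀ i, IsFiniteMeasure (ρ i)] :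
    ((Measure.pi ρ).prod (Measure.pi ρ)).map (fun p => p.1 ⊓ p.2) ≪ Measure.pi ρ := by
  have he := measurePreserving_arrowProdEquivProdArrow ℝ ℝ ι ρ ρ
  have hm : Measurable fun p : (ι → ℝ) × (ι → ℝ) => p.1 ⊓ p.2 := measurable_inf_pi
  have h1 : ((Measure.pi ρ).prod (Measure.pi ρ)).map (fun p => p.1 ⊓ p.2) =
      (Measure.pi fun i => (ρ i).prod (ρ i)).map (fun w i => min (w i).1 (w i).2) := by
    rw [← he.map_eq, Measure.map_map hm (MeasurableEquiv.measurable _)]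
    rfl
  haveI : ∀ i, SigmaFinite (((ρ i).prod (ρ i)).map fun q : ℝ × ℝ => min q.1 q.2) := fun i =>
    (Measure.isFiniteMeasure_map _ _).toSigmaFinite
  rw [h1, Measure.pi_map_pi fun i => (measurable_fst.min measurable_snd).aemeasurable]
  exact pi_absolutelyContinuous_pi fun i => map_min_prod_absolutelyContinuous (ρ i)

/-- **Quasi-invariance under the join.** [this work] -/
theorem prod_map_sup_absolutelyContinuous (ρ : ι → Measure ℝ) [∀ i, IsFiniteMeasure (ρ i)] :
    ((Measure.pi ρ).prod (Measure.pi ρ)).map (fun p => p.1 ⊔ p.2) ≪ Measure.pi ρ := by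
  have he := measurePreserving_arrowProdEquivProdArrow ℝ ℝ ι ρ ρ
  have hm : Measurable fun p : (ι → ℝ) × (ι → ℝ) => p.1 ⊔ p.2 := measurable_sup_pi
  have h1 : ((Measure.pi ρ).prod (Measure.pi ρ)).map (fun p => p.1 ⊔ p.2) =
      (Measure.pi fun i => (ρ i).prod (ρ i)).map (fun w i => max (w i).1 (w i).2) := by
    rw [← he.map_eq, Measure.map_map hm (MeasurableEquiv.measurable _)]
    rfl
  haveI : ∀ i, SigmaFinite (((ρ i).prod (ρ i)).map fun q : ℝ × ℝ => max q.1 q.2) := fun i =>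
    (Measure.isFiniteMeasure_map _ _).toSigmaFinite
  rw [h1, Measure.pi_map_pi fun i => (measurable_fst.max measurable_snd).aemeasurable]
  exact pi_absolutelyContinuous_pi fun i => map_max_prod_absolutelyContinuous (ρ i)

/-- Hence a `π`-null set is avoided by `u ∧ v` and `u ∨ v` for `π ⊗ π`-a.e. `(u,v)`. [this work] -/
theorem ae_prod_inf_sup_mem (ρ : ι → Measure ℝ) [∀ i, IsFiniteMeasure (ρ i)] {G : Set (ι → ℝ)}
    (hG : ∀ᵐ u ∂Measure.pi ρ, u ∈ G) :
    ∀ᵐ p ∂(Measure.pi ρ).prod (Measure.pi ρ), p.1 ⊓ p.2 ∈ G ∧ p.1 ⊔ p.2 ∈ G := by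
  have h1 : ∀ᵐ p ∂(Measure.pi ρ).prod (Measure.pi ρ), p.1 ⊓ p.2 ∈ G :=
    ae_of_ae_map measurable_inf_pi.aemeasurable ((prod_map_inf_absolutelyContinuous ρ).ae_le hG)
  have h2 : ∀ᵐ p ∂(Measure.pi ρ).prod (Measure.pi ρ), p.1 ⊔ p.2 ∈ G :=
    ae_of_ae_map measurable_sup_pi.aemeasurable ((prod_map_sup_absolutelyContinuous ρ).ae_le hG)
  filter_upwards [h1, h2] with p hp1 hp2 using ⟨hp1, hp2⟩

end QuasiInvariance

/-! ### Sup-norm balls are closed boxes; the product identity -/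

section Balls

/-- Sup-norm closed balls of `ℝ^ι` are closed boxes. [folklore] -/
theorem closedBall_eq_Icc_pi (w : ι → ℝ) {r : ℝ} (hr : 0 ≤ r) :
    closedBall w r = Icc (fun i => w i - r) (fun i => w i + r) := by
  rw [closedBall_pi w hr, ← Set.pi_univ_Icc]
  congr 1
  funext i
  exact Real.closedBall_eq_Icc

/-- **The product identity**: `π(B(u,r)) π(B(v,r)) = π(B(u ∧ v,r)) π(B(u ∨ v,r))` for a product measure `π` (coordinate by
coordinate `{uᵢ, vᵢ} = {uᵢ ∧ vᵢ, uᵢ ∨ vᵢ}`). [this work] -/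
theorem pi_closedBall_mul_eq (ρ : ι → Measure ℝ) [∀ i, SigmaFinite (ρ i)] (u v : ι → ℝ) {r : ℝ} (hr : 0 ≤ r) :
    Measure.pi ρ (closedBall u r) * Measure.pi ρ (closedBall v r) =
      Measure.pi ρ (closedBall (u ⊓ v) r) * Measure.pi ρ (closedBall (u ⊔ v) r) := by
  simp only [closedBall_pi _ hr, Measure.pi_pi, ← Finset.prod_mul_distrib]
  refine Finset.prod_congr rfl fun i _ => ?_
  show ρ i (closedBall (u i) r) * ρ i (closedBall (v i) r) =
    ρ i (closedBall (u i ⊓ v i) r) * ρ i (closedBall (u i ⊔ v i) r)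
  rcases le_total (u i) (v i) with h | h
  · rw [inf_eq_left.2 h, sup_eq_right.2 h]
  · rw [inf_eq_right.2 h, sup_eq_left.2 h, mul_comm]

variable {Y : Type*} [MeasurableSpace Y] [Lattice Y]

/-- The box form of (5.1) on sup-norm balls. [this work] -/
theorem ball_mul_le_of_isCMTP2Box (μ : Measure ((ι → ℝ) × Y)) (h : IsCMTP2Box μ) (u v : ι → ℝ) {r : ℝ}
    (hr : 0 ≤ r) (x y : Y) :
    μ (closedBall u r ×ˢ Iic x) * μ (closedBall v r ×ˢ Iic y) ≤
      μ (closedBall (u ⊓ v) r ×ˢ Iic (x ⊓ y)) * μ (closedBall (u ⊔ v) r ×ˢ Iic (x ⊔ y)) := by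
  simp only [closedBall_eq_Icc_pi _ hr]
  have h1 := h (fun i => u i - r) (fun i => u i + r) (fun i => v i - r) (fun i => v i + r) x y
  have e1 : ((fun i => u i - r) ⊓ fun i => v i - r) = fun i => (u ⊓ v) i - r :=
    funext fun i => min_sub_sub_right _ _ _
  have e2 : ((fun i => u i + r) ⊓ fun i => v i + r) = fun i => (u ⊓ v) i + r :=
    funext fun i => min_add_add_right _ _ _
  have e3 : ((fun i => u i - r) ⊔ fun i => v i - r) = fun i => (u ⊔ v) i - r :=
    funext fun i => max_sub_sub_right _ _ _
  have e4 : ((fun i => u i + r) ⊔ fun i => v i + r) = fun i => (u ⊔ v) i + r :=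
    funext fun i => max_add_add_right _ _ _
  rwa [e1, e2, e3, e4] at h1

/-- The ratio arithmetic: `ab ≤ a'b'` and `pq = p'q'` give `(a/p)(b/q) ≤ (a'/p')(b'/q')` (finite denominators; a
vanishing denominator forces a vanishing numerator). [folklore] -/
theorem div_mul_div_le_of_mul_le {a b a' b' p q p' q' : ℝ≥0∞} (hab : a * b ≤ a' * b') (hpq : p * q = p' * q')
    (ha : p = 0 → a = 0) (hb : q = 0 → b = 0) (hp : p ≠ ∞) (hp' : p' ≠ ∞) :
    a / p * (b / q) ≤ a' / p' * (b' / q') := by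
  by_cases hp0 : p = 0
  · rw [ha hp0, hp0, ENNReal.zero_div, zero_mul]; exact bot_le
  by_cases hq0 : q = 0
  · rw [hb hq0, hq0, ENNReal.zero_div, mul_zero]; exact bot_le
  have hne : p * q ≠ 0 := mul_ne_zero hp0 hq0
  have hp'0 : p' ≠ 0 := fun h0 => hne (by rw [hpq, h0, zero_mul])
  calc a / p * (b / q) = a * b / (p * q) := by
        rw [div_eq_mul_inv, div_eq_mul_inv, div_eq_mul_inv, ENNReal.mul_inv (Or.inl hp0) (Or.inl hp),
          mul_mul_mul_comm]
    _ ≤ a' * b' / (p * q) := ENNReal.div_le_div_right hab _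
    _ = a' * b' / (p' * q') := by rw [hpq]
    _ = a' / p' * (b' / q') := by
        rw [div_eq_mul_inv, div_eq_mul_inv, div_eq_mul_inv, ENNReal.mul_inv (Or.inl hp'0) (Or.inl hp'),
          mul_mul_mul_comm]

end Balls

/-! ### The slices as densities, and the a.e. mtp₂ inequality -/

section Converse

variable {Y : Type*} [MeasurableSpace Y] [Lattice Y] [TopologicalSpace Y] [OpensMeasurableSpace Y]
  [ClosedIicTopology Y]

omit [Fintype ι] in
/-- **The slices are `π`-with-density `g(·,z) = K(·)(−∞,z] · f`.** [this work] -/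
theorem slice_eq_withDensity (π : Measure (ι → ℝ)) [SFinite π] (f : (ι → ℝ) → ℝ≥0∞) (hf : Measurable f)
    (K : Kernel (ι → ℝ) Y) [IsSFiniteKernel K] (μ : Measure ((ι → ℝ) × Y)) (hfst : μ.fst = π.withDensity f)
    (hdis : μ.fst ⊗ₘ K = μ) (z : Y) :
    (μ.restrict (univ ×ˢ Iic z)).map Prod.fst = π.withDensity (fun u => K u (Iic z) * f u) := by
  ext S hS
  rw [map_fst_restrict_prod_Iic_apply μ z hS, prod_Iic_eq_lintegral_indicator π f hf K μ hfst hdis hS z,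
    withDensity_apply _ hS, lintegral_indicator hS]

/-- **[FuchsWang2026] (5.1) ⟹ (1.2) ALMOST EVERYWHERE.**  Let the first marginal of the finite law `μ` on `ℝ^A × Y` have a
measurable density `f` with respect to a product `π = ⊗ᵢ ρᵢ` of finite measures, and let `K` be a Markov version of the
conditional law of the second block (`μ^A ⊗ K = μ`).  If `μ` satisfies the box form of (5.1), then for all `x, y` the
function `g(u,z) = K(u)(−∞,z] f(u)` of (1.2) satisfies `g(u,x) g(v,y) ≤ g(u∧v, x∧y) g(u∨v, x∨y)` for `π ⊗ π`-almost every
pair `(u,v)`. [this work] -/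
theorem ae_pair_mtp2_of_isCMTP2Box (ρ : ι → Measure ℝ) [∀ i, IsFiniteMeasure (ρ i)] (f : (ι → ℝ) → ℝ≥0∞)
    (hf : Measurable f) (K : Kernel (ι → ℝ) Y) [IsMarkovKernel K] (μ : Measure ((ι → ℝ) × Y)) [IsFiniteMeasure μ]
    (hfst : μ.fst = (Measure.pi ρ).withDensity f) (hdis : μ.fst ⊗ₘ K = μ) (h : IsCMTP2Box μ) (x y : Y) :
    ∀ᵐ p ∂((Measure.pi ρ).prod (Measure.pi ρ)),
      (K p.1 (Iic x) * f p.1) * (K p.2 (Iic y) * f p.2) ≤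
        (K (p.1 ⊓ p.2) (Iic (x ⊓ y)) * f (p.1 ⊓ p.2)) * (K (p.1 ⊔ p.2) (Iic (x ⊔ y)) * f (p.1 ⊔ p.2)) := by
  set π := Measure.pi ρ with hπ
  set g : Y → (ι → ℝ) → ℝ≥0∞ := fun z u => K u (Iic z) * f u with hg
  have hgm : ∀ z, Measurable (g z) := fun z => (K.measurable_coe measurableSet_Iic).mul hf
  set ν : Y → Measure (ι → ℝ) := fun z => (μ.restrict (univ ×ˢ Iic z)).map Prod.fst with hν
  have hνd : ∀ z, ν z = π.withDensity (g z) := fun z => slice_eq_withDensity π f hf K μ hfst hdis z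
  have hνapp : ∀ (z : Y) (w : ι → ℝ) (r : ℝ), ν z (closedBall w r) = μ (closedBall w r ×ˢ Iic z) :=
    fun z w r => map_fst_restrict_prod_Iic_apply μ z measurableSet_closedBall
  haveI : ∀ z, IsFiniteMeasure (ν z) := fun z => by rw [hν]; infer_instance
  -- Besicovitch–Lebesgue differentiation of the slices
  have hdiff : ∀ z, ∀ᵐ u ∂π, Tendsto (fun r => ν z (closedBall u r) / π (closedBall u r)) (𝓝[>] 0) (𝓝 (g z u)) := by
    intro z
    have h2 : (ν z).rnDeriv π =ᵐ[π] g z := by rw [hνd z]; exact Measure.rnDeriv_withDensity π (hgm z)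
    filter_upwards [Besicovitch.ae_tendsto_rnDeriv (ν z) π, h2] with u hu hu2
    rwa [hu2] at hu
  -- the density is finite a.e.
  have hftop : ∀ᵐ u ∂π, f u < ∞ := by
    refine ae_lt_top hf ?_
    have h1 : ∫⁻ u, f u ∂π = μ.fst univ := by
      rw [hfst, withDensity_apply _ MeasurableSet.univ, Measure.restrict_univ]
    rw [h1]; exact measure_ne_top _ _
  have hgfin : ∀ z u, f u < ∞ → g z u ≠ ∞ := fun z u hfu =>
    ne_top_of_le_ne_top hfu.ne (mul_le_of_le_one_left' prob_le_one)
  -- the good set and its transfer to pairs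
  have hgood : ∀ᵐ u ∂π,
      (Tendsto (fun r => ν x (closedBall u r) / π (closedBall u r)) (𝓝[>] 0) (𝓝 (g x u)) ∧
        Tendsto (fun r => ν y (closedBall u r) / π (closedBall u r)) (𝓝[>] 0) (𝓝 (g y u)) ∧
        Tendsto (fun r => ν (x ⊓ y) (closedBall u r) / π (closedBall u r)) (𝓝[>] 0) (𝓝 (g (x ⊓ y) u)) ∧
        Tendsto (fun r => ν (x ⊔ y) (closedBall u r) / π (closedBall u r)) (𝓝[>] 0) (𝓝 (g (x ⊔ y) u))) ∧
      f u < ∞ := by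
    filter_upwards [hdiff x, hdiff y, hdiff (x ⊓ y), hdiff (x ⊔ y), hftop] with u h1 h2 h3 h4 h5
    exact ⟨⟨h1, h2, h3, h4⟩, h5⟩
  filter_upwards [(Measure.quasiMeasurePreserving_fst (μ := π) (ν := π)).tendsto_ae.eventually hgood,
    (Measure.quasiMeasurePreserving_snd (μ := π) (ν := π)).tendsto_ae.eventually hgood,
    ae_prod_inf_sup_mem ρ hgood] with p hu hv huv
  obtain ⟨⟨hux, -, -, -⟩, hfu⟩ := hu
  obtain ⟨⟨-, hvy, -, -⟩, hfv⟩ := hv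
  obtain ⟨⟨⟨-, -, hm, -⟩, hfm⟩, ⟨⟨-, -, -, hj⟩, hfj⟩⟩ := huv
  have hL := ENNReal.Tendsto.mul hux (Or.inr (hgfin _ _ hfv)) hvy (Or.inr (hgfin _ _ hfu))
  have hR := ENNReal.Tendsto.mul hm (Or.inr (hgfin _ _ hfj)) hj (Or.inr (hgfin _ _ hfm))
  refine le_of_tendsto_of_tendsto hL hR (eventually_nhdsWithin_of_forall fun r (hr : 0 < r) => ?_)
  -- the ratio inequality at radius `r`
  have hnull : ∀ (z : Y) (w : ι → ℝ), π (closedBall w r) = 0 → ν z (closedBall w r) = 0 := fun z w h0 => by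
    rw [hνd z]; exact withDensity_absolutelyContinuous π (g z) h0
  show ν x (closedBall p.1 r) / π (closedBall p.1 r) * (ν y (closedBall p.2 r) / π (closedBall p.2 r)) ≤
    ν (x ⊓ y) (closedBall (p.1 ⊓ p.2) r) / π (closedBall (p.1 ⊓ p.2) r) *
      (ν (x ⊔ y) (closedBall (p.1 ⊔ p.2) r) / π (closedBall (p.1 ⊔ p.2) r))
  refine div_mul_div_le_of_mul_le ?_ (pi_closedBall_mul_eq ρ p.1 p.2 hr.le) (hnull x p.1) (hnull y p.2)
    (measure_ne_top _ _) (measure_ne_top _ _)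
  rw [hνapp, hνapp, hνapp, hνapp]
  exact ball_mul_le_of_isCMTP2Box μ h p.1 p.2 hr.le x y

/-- The same from (5.1) itself. [this work] -/
theorem ae_pair_mtp2_of_isCMTP2Set (ρ : ι → Measure ℝ) [∀ i, IsFiniteMeasure (ρ i)] (f : (ι → ℝ) → ℝ≥0∞)
    (hf : Measurable f) (K : Kernel (ι → ℝ) Y) [IsMarkovKernel K] (μ : Measure ((ι → ℝ) × Y)) [IsFiniteMeasure μ]
    (hfst : μ.fst = (Measure.pi ρ).withDensity f) (hdis : μ.fst ⊗ₘ K = μ) (h : IsCMTP2Set μ) (x y : Y) :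
    ∀ᵐ p ∂((Measure.pi ρ).prod (Measure.pi ρ)),
      (K p.1 (Iic x) * f p.1) * (K p.2 (Iic y) * f p.2) ≤
        (K (p.1 ⊓ p.2) (Iic (x ⊓ y)) * f (p.1 ⊓ p.2)) * (K (p.1 ⊔ p.2) (Iic (x ⊔ y)) * f (p.1 ⊔ p.2)) :=
  ae_pair_mtp2_of_isCMTP2Box ρ f hf K μ hfst hdis (isCMTP2Box_of_isCMTP2Set h) x y

end Converse

end Summit.CriticalPhenomena.PercolationContinuityZ3.Theorems.SahiCMTP2
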